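import Literature.NumberTheory.LFunctions.RudnickSarnakNSliceSum
import Literature.NumberTheory.LFunctions.RudnickSarnakNCoefficients
import Mathlib.MeasureTheory.Integral.Prod
import HarnessLib

/-!
# Rudnick–Sarnak `n`-level correlations for `ζ`, X: the decomposition of one slot and of the product

Sibling file of `Literature/NumberTheory/LFunctions/RudnickSarnak.lean` (toward
`Literature.NumberTheory.LFunctions.rudnick_sarnak_unrestricted` at every level). For one slot the
windowed zero sum is (RH; `RudnickSarnakNExplicit.lean`)

  `S⁺(a, t) = e^{iat} B(a, t) + R(a, t)`,  `B = 𝒟 − 𝒜` (`RudnickSarnakN.slotB`),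

with `R` = polar terms minus conjugate zeros (`RudnickSarnakN.slotRem`), and the bounds
`‖𝒜(a, t)‖ ≤ C₁ e^{|a|/2}` (Chebyshev), `‖B(a, t)‖ ≤ C_B (log(|t|+2)+1) e^{|a|/2}`,
`‖R(a, t)‖ ≤ C_R e^{|a|/2}/(1+t²)` (`t ≥ 0`). For an `n`-tuple of frequencies with `Σ_j a_j = 0`
(the slice) the phases cancel and (Rudnick–Sarnak 1996, (3.12)–(3.20): expanding the product of
the `n` explicit formulas; the terms with a polar factor are `O(T^{1−δ/2})`, cf. (3.15))

  `‖Π_j S⁺(a_j, t) − Π_j B(a_j, t)‖ ≤ (2K)ⁿ (log(t+2)+1)ⁿ e^{Σ|a_j|/2}/(1+t²)`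
  (`RudnickSarnakN.norm_prod_zeroSumPlus_sub_prod_slotB_le`).

Also: joint continuity of `(a, t) ↦ S⁺(a, t)`, continuity of `t ↦ 𝒟(a, t)`, `𝒜(a, t)`, and the
single application of Fubini used downstream:
`sliceIntegral Φ T = ∫_η Φ(ξ(η)) (∫_0^T Π_j S⁺(−Lξ_j(η), t) dt) dη`
(`RudnickSarnakN.sliceIntegral_eq_integral_slotIntegral`).

## References

* Z. Rudnick, P. Sarnak, *Zeros of principal `L`-functions and random matrix theory*, Duke Math.
  J. 81 (1996), 269–322, (3.12)–(3.20).
-/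

noncomputable section

open Complex Filter Set MeasureTheory Finset
open scoped Real Topology ComplexConjugate

namespace Literature.NumberTheory.LFunctions

namespace RudnickSarnakN

open Literature.Analysis.SpecialFunctions (reDigammaQuarter continuous_reDigammaQuarter abs_reDigammaQuarter_le)

variable {k : ℕ}

/-! ## Size of the prime polynomial -/

/-- **`‖𝒜(a, t)‖ ≤ C₁ e^{|a|/2}`** (Chebyshev on the window `e^{|a|−1/4} < n < e^{|a|+1/4}`).
[cite: RudnickSarnak1996, (2.7)] -/
theorem norm_primePoly_le (a t : ℝ) : ‖primePoly a t‖ ≤ coefL1Const * Real.exp (|a| / 2) := by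
  have key : ∀ b : ℝ, 0 ≤ b → ‖dirPoly (suppBound b) (fun n ↦ ((coefAF b n : ℝ) : ℂ)) t‖ ≤ coefL1Const * Real.exp (b / 2) := by
    intro b _
    refine (norm_dirPoly_le _ _ _).trans ?_
    have e : ∀ n, ‖((coefAF b n : ℝ) : ℂ)‖ = coefR b n := fun n ↦ by
      rw [Complex.norm_real, coefAF_apply, Real.norm_of_nonneg (coefR_nonneg _ _)]
    simp_rw [e]
    exact sum_coefR_le b _
  rcases le_or_gt 0 a with ha | ha
  · rw [primePoly_eq_dirPoly ha, abs_of_nonneg ha]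
    exact key a ha
  · rw [primePoly_eq_conj_dirPoly ha.le, Complex.norm_conj, abs_of_neg ha]
    exact key (-a) (by linarith)

/-! ## The slot terms `B = 𝒟 − 𝒜` and `R` -/

/-- `B(a, t) := 𝒟(a, t) − 𝒜(a, t)`. [cite: RudnickSarnak1996, (3.12)] -/
def slotB (a t : ℝ) : ℂ :=
  archTerm a t - primePoly a t

/-- The constant of the bound on `B`. [folklore] -/
def slotBConst : ℝ :=
  3 * bumpMass + archErrConst + coefL1Const

/-- `slotBConst > 0`. [folklore] -/
theorem slotBConst_pos : 0 < slotBConst := by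
  unfold slotBConst
  have := bumpMass_pos; have := archErrConst_nonneg; have := coefL1Const_pos
  linarith

/-- **`‖B(a, t)‖ ≤ C_B (log(|t|+2) + 1) e^{|a|/2}`.** [cite: RudnickSarnak1996, Lemma 3.1] -/
theorem norm_slotB_le (a t : ℝ) : ‖slotB a t‖ ≤ slotBConst * (Real.log (|t| + 2) + 1) * Real.exp (|a| / 2) := by
  unfold slotB slotBConst
  have h1 := norm_archTerm_le a t
  have h2 := norm_primePoly_le a t
  have hlog : 0 ≤ Real.log (|t| + 2) := Real.log_nonneg (by linarith [abs_nonneg t])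
  have hexp : 1 ≤ Real.exp (|a| / 2) := Real.one_le_exp (by positivity)
  have hb := bumpMass_pos; have hA := archErrConst_nonneg; have hC := coefL1Const_pos
  calc ‖archTerm a t - primePoly a t‖ ≤ ‖archTerm a t‖ + ‖primePoly a t‖ := norm_sub_le _ _
    _ ≤ (bumpMass * (Real.log (|t| + 2) + 3) + archErrConst) + coefL1Const * Real.exp (|a| / 2) := add_le_add h1 h2
    _ ≤ (3 * bumpMass + archErrConst + coefL1Const) * (Real.log (|t| + 2) + 1) * Real.exp (|a| / 2) := by
        have e1 : bumpMass * (Real.log (|t| + 2) + 3) ≤ 3 * bumpMass * (Real.log (|t| + 2) + 1) := by nlinarith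
        have e2 : archErrConst ≤ archErrConst * (Real.log (|t| + 2) + 1) := by nlinarith
        have e3 : coefL1Const * Real.exp (|a| / 2) ≤ coefL1Const * (Real.log (|t| + 2) + 1) * Real.exp (|a| / 2) := by
          nlinarith [mul_pos hC (Real.exp_pos (|a| / 2))]
        nlinarith [mul_nonneg (mul_nonneg (by linarith : (0:ℝ) ≤ 3 * bumpMass + archErrConst) hlog) (Real.exp_pos (|a|/2)).le,
          mul_nonneg (by linarith : (0:ℝ) ≤ 3 * bumpMass + archErrConst) (by linarith : (0:ℝ) ≤ Real.exp (|a| / 2) - 1)]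

/-- The constant of `‖S⁻‖ ≤ C/(1+t²)` (`exists_norm_zeroSumMinus_le`). [folklore] -/
def minusConst : ℝ :=
  Classical.choose exists_norm_zeroSumMinus_le

/-- Specification of `minusConst`. [folklore] -/
theorem minusConst_spec : 0 ≤ minusConst ∧ ∀ a t : ℝ, 0 ≤ t → ‖zeroSumMinus a t‖ ≤ minusConst / (1 + t ^ 2) :=
  Classical.choose_spec exists_norm_zeroSumMinus_le

/-- The constant of the bound on the remainder `R`. [folklore] -/
def remConst : ℝ :=
  2 * weilDecayConst g0 + minusConst

/-- `remConst ≥ 0`. [folklore] -/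
theorem remConst_nonneg : 0 ≤ remConst := by
  unfold remConst
  have := weilDecayConst_nonneg g0; have := minusConst_spec.1
  linarith

/-- The remainder of one slot: `R(a, t) := S⁺(a, t) − e^{iat} B(a, t)`. [cite: RudnickSarnak1996, (3.13)] -/
def slotRem (a t : ℝ) : ℂ :=
  zeroSumPlus a t - cexp (((t * a : ℝ) : ℂ) * I) * slotB a t

/-- `S⁺ = e^{iat} B + R` (definition). [folklore] -/
theorem zeroSumPlus_eq (a t : ℝ) : zeroSumPlus a t = cexp (((t * a : ℝ) : ℂ) * I) * slotB a t + slotRem a t := by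
  unfold slotRem; ring

/-- Under RH, `R(a, t) = e^{−a/2} ĝ₀(−it) + e^{a/2} ĝ₀(1 − it) − S⁻(a, t)`. [cite: RudnickSarnak1996, (3.13)] -/
theorem slotRem_eq (hRH : RiemannHypothesis) (a t : ℝ) :
    slotRem a t = (Real.exp (-(a / 2)) : ℂ) * weilMellin g0 (-(t * I)) +
      (Real.exp (a / 2) : ℂ) * weilMellin g0 (1 - t * I) - zeroSumMinus a t := by
  have h := zeroSumPlus_add_zeroSumMinus hRH a t
  unfold slotRem slotB
  linear_combination h

/-- **`‖R(a, t)‖ ≤ C_R e^{|a|/2}/(1 + t²)`** for `t ≥ 0` (RH). [cite: RudnickSarnak1996, (3.15)] -/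
theorem norm_slotRem_le (hRH : RiemannHypothesis) (a : ℝ) {t : ℝ} (ht : 0 ≤ t) :
    ‖slotRem a t‖ ≤ remConst * Real.exp (|a| / 2) / (1 + t ^ 2) := by
  rw [slotRem_eq hRH]
  have h0 : ‖weilMellin g0 (-(t * I))‖ ≤ weilDecayConst g0 / (1 + t ^ 2) := by
    have := norm_weilMellin_g0_le (σ := 0) le_rfl zero_le_one (-t)
    have e : ((0 : ℝ) : ℂ) + ((-t : ℝ) : ℂ) * I = -(t * I) := by push_cast; ring
    rw [e] at this; simpa using this
  have h1 : ‖weilMellin g0 (1 - t * I)‖ ≤ weilDecayConst g0 / (1 + t ^ 2) := by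
    have := norm_weilMellin_g0_le (σ := 1) zero_le_one le_rfl (-t)
    have e : ((1 : ℝ) : ℂ) + ((-t : ℝ) : ℂ) * I = 1 - t * I := by push_cast; ring
    rw [e] at this; simpa using this
  have h2 := minusConst_spec.2 a t ht
  have hea : Real.exp (-(a / 2)) ≤ Real.exp (|a| / 2) := Real.exp_le_exp.2 (by linarith [neg_abs_le a])
  have heb : Real.exp (a / 2) ≤ Real.exp (|a| / 2) := Real.exp_le_exp.2 (by linarith [le_abs_self a])
  have hW := weilDecayConst_nonneg g0
  have hM := minusConst_spec.1
  have hpos : 0 < 1 + t ^ 2 := by positivity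
  have hexp1 : 1 ≤ Real.exp (|a| / 2) := Real.one_le_exp (by positivity)
  calc ‖(Real.exp (-(a / 2)) : ℂ) * weilMellin g0 (-(t * I)) + (Real.exp (a / 2) : ℂ) * weilMellin g0 (1 - t * I) - zeroSumMinus a t‖
      ≤ ‖(Real.exp (-(a / 2)) : ℂ) * weilMellin g0 (-(t * I))‖ + ‖(Real.exp (a / 2) : ℂ) * weilMellin g0 (1 - t * I)‖ + ‖zeroSumMinus a t‖ :=
        (norm_sub_le _ _).trans (add_le_add (norm_add_le _ _) le_rfl)
    _ ≤ Real.exp (|a| / 2) * (weilDecayConst g0 / (1 + t ^ 2)) + Real.exp (|a| / 2) * (weilDecayConst g0 / (1 + t ^ 2)) +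
          minusConst / (1 + t ^ 2) := by
        refine add_le_add (add_le_add ?_ ?_) h2
        · rw [norm_mul, Complex.norm_real, Real.norm_of_nonneg (Real.exp_pos _).le]
          exact mul_le_mul hea h0 (norm_nonneg _) (Real.exp_pos _).le
        · rw [norm_mul, Complex.norm_real, Real.norm_of_nonneg (Real.exp_pos _).le]
          exact mul_le_mul heb h1 (norm_nonneg _) (Real.exp_pos _).le
    _ ≤ remConst * Real.exp (|a| / 2) / (1 + t ^ 2) := by
        unfold remConst
        have e : Real.exp (|a| / 2) * (weilDecayConst g0 / (1 + t ^ 2)) + Real.exp (|a| / 2) * (weilDecayConst g0 / (1 + t ^ 2)) +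
            minusConst / (1 + t ^ 2) = (2 * weilDecayConst g0 * Real.exp (|a| / 2) + minusConst) / (1 + t ^ 2) := by
          field_simp
          ring
        rw [e]
        refine div_le_div_of_nonneg_right ?_ hpos.le
        nlinarith

/-! ## Continuity -/

/-- **Joint continuity of the windowed zero sum** `(a, t) ↦ S⁺(a, t)` (locally uniform convergence of
the series). [folklore] -/
theorem continuous_zeroSumPlus_uncurry : Continuous fun p : ℝ × ℝ ↦ zeroSumPlus p.1 p.2 := by
  rw [continuous_iff_continuousAt]
  rintro ⟨a₀, t₀⟩
  set M : ℝ := |t₀| + 1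
  obtain ⟨C, hC0, hC⟩ := exists_ker_le
  have hcont : ContinuousOn (fun p : ℝ × ℝ ↦ zeroSumPlus p.1 p.2) (univ ×ˢ Icc (-M) M) := by
    have hu : ∀ n : ℕ, ∀ p ∈ univ ×ˢ Icc (-M) M,
        ‖cexp (((p.1 * zetaOrdinate n : ℝ) : ℂ) * I) * (ker (p.2 - zetaOrdinate n) : ℂ)‖ ≤
          C * (2 * (1 + M ^ 2)) * (1 / (1 + zetaOrdinate n ^ 2)) := by
      rintro n ⟨a, t⟩ ⟨-, ht⟩
      rw [norm_mul, Complex.norm_exp_ofReal_mul_I, one_mul, Complex.norm_real, Real.norm_of_nonneg (ker_nonneg _)]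
      have h1 : C / (1 + (t - zetaOrdinate n) ^ 2) ^ 2 ≤ C / (1 + (t - zetaOrdinate n) ^ 2) := by
        refine div_le_div_of_nonneg_left hC0.le (by positivity) ?_
        nlinarith [sq_nonneg (t - zetaOrdinate n)]
      have ht2 : t ^ 2 ≤ M ^ 2 := by
        have htM : |t| ≤ M := abs_le.2 ⟨ht.1, ht.2⟩
        nlinarith [abs_nonneg t, sq_abs t]
      calc ker (t - zetaOrdinate n) ≤ C / (1 + (t - zetaOrdinate n) ^ 2) ^ 2 := hC _
        _ ≤ C * (1 / (1 + (t - zetaOrdinate n) ^ 2)) := by rw [mul_one_div]; exact h1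
        _ ≤ C * (2 * (1 + t ^ 2) / (1 + zetaOrdinate n ^ 2)) :=
            mul_le_mul_of_nonneg_left (OrdinateDictionary.one_div_one_add_sq_sub_le t _) hC0.le
        _ ≤ C * (2 * (1 + M ^ 2) / (1 + zetaOrdinate n ^ 2)) := by gcongr
        _ = C * (2 * (1 + M ^ 2)) * (1 / (1 + zetaOrdinate n ^ 2)) := by ring
    have h := continuousOn_tsum (fun n ↦ ?_) (Montgomery.summable_one_div_one_add_zetaOrdinate_sq.mul_left _) hu
    · exact h
    · exact (Continuous.mul (by fun_prop) (Complex.continuous_ofReal.comp (continuous_ker.comp (by fun_prop)))).continuousOn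
  refine hcont.continuousAt (prod_mem_nhds univ_mem (Icc_mem_nhds ?_ ?_))
  · simp [M]; linarith [abs_nonneg t₀, neg_abs_le t₀]
  · simp [M]; linarith [le_abs_self t₀]

/-- Continuity of `t ↦ S⁺(a, t)`. [folklore] -/
theorem continuous_zeroSumPlus (a : ℝ) : Continuous (zeroSumPlus a) :=
  continuous_zeroSumPlus_uncurry.comp (Continuous.prodMk_right a)

/-- Continuity of `t ↦ 𝒜(a, t)` (a finite Dirichlet polynomial). [folklore] -/
theorem continuous_primePoly (a : ℝ) : Continuous (primePoly a) := by
  rcases le_or_gt 0 a with ha | ha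
  · have : primePoly a = fun t ↦ dirPoly (suppBound a) (fun n ↦ ((coefAF a n : ℝ) : ℂ)) t := funext (primePoly_eq_dirPoly ha)
    rw [this]; exact continuous_dirPoly _ _
  · have : primePoly a = fun t ↦ conj (dirPoly (suppBound (-a)) (fun n ↦ ((coefAF (-a) n : ℝ) : ℂ)) t) :=
      funext (primePoly_eq_conj_dirPoly ha.le)
    rw [this]; exact Complex.continuous_conj.comp (continuous_dirPoly _ _)

/-- Continuity of `t ↦ 𝒟(a, t)` (dominated convergence under the integral). [folklore] -/
theorem continuous_archTerm (a : ℝ) : Continuous (archTerm a) := by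
  unfold archTerm
  refine (continuous_const.mul ?_).sub continuous_const
  obtain ⟨C, hC0, hC⟩ := exists_ker_le_cube
  rw [continuous_iff_continuousAt]
  intro t₀
  set M : ℝ := |t₀| + 1
  -- dominate on `|t| ≤ M` by `C(|λ0| + 54 s² + 54 M²)/(1+s²)³ ≤ K (1+s²)⁻¹`
  set K : ℝ := C * (|reDigammaQuarter 0| + 54 + 54 * M ^ 2)
  have hK0 : 0 ≤ K := by positivity
  refine continuousAt_of_dominated (bound := fun s ↦ K * (1 + s ^ 2)⁻¹) ?_ ?_ ?_ ?_
  · refine Eventually.of_forall fun t ↦ Continuous.aestronglyMeasurable ?_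
    exact Continuous.mul (Continuous.mul (by fun_prop) (Complex.continuous_ofReal.comp continuous_ker))
      (Complex.continuous_ofReal.comp (continuous_reDigammaQuarter.comp (continuous_id.add continuous_const)))
  · have hnhds : Icc (-M) M ∈ 𝓝 t₀ := Icc_mem_nhds (by simp [M]; linarith [abs_nonneg t₀, neg_abs_le t₀]) (by simp [M]; linarith [le_abs_self t₀])
    refine Filter.eventually_of_mem hnhds fun t ht ↦ Eventually.of_forall fun s ↦ ?_
    rw [norm_mul, norm_mul, Complex.norm_exp_ofReal_mul_I, one_mul, Complex.norm_real, Complex.norm_real,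
      Real.norm_of_nonneg (ker_nonneg s), Real.norm_eq_abs]
    have hlam := abs_reDigammaQuarter_le (s + t)
    have hk := hC s
    have hks := ker_nonneg s
    have ht2 : t ^ 2 ≤ M ^ 2 := by
      have htM : |t| ≤ M := abs_le.2 ⟨ht.1, ht.2⟩
      nlinarith [abs_nonneg t, sq_abs t]
    have hst : (s + t) ^ 2 ≤ 2 * s ^ 2 + 2 * M ^ 2 := by nlinarith [sq_nonneg (s - t)]
    have hpos : 0 < 1 + s ^ 2 := by positivity
    calc ker s * |reDigammaQuarter (s + t)| ≤ C / (1 + s ^ 2) ^ 3 * (|reDigammaQuarter 0| + 27 * (s + t) ^ 2) :=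
          mul_le_mul hk hlam (abs_nonneg _) (by positivity)
      _ ≤ C / (1 + s ^ 2) ^ 3 * (|reDigammaQuarter 0| + 54 * s ^ 2 + 54 * M ^ 2) := by
          refine mul_le_mul_of_nonneg_left ?_ (by positivity); nlinarith
      _ ≤ K * (1 + s ^ 2)⁻¹ := by
          simp only [K]
          rw [div_mul_eq_mul_div, div_le_iff₀ (by positivity)]
          have hl0 := abs_nonneg (reDigammaQuarter 0)
          have e3 : C * (|reDigammaQuarter 0| + 54 + 54 * M ^ 2) * (1 + s ^ 2)⁻¹ * (1 + s ^ 2) ^ 3 =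
              C * ((|reDigammaQuarter 0| + 54 + 54 * M ^ 2) * (1 + s ^ 2) ^ 2) := by
            field_simp
          rw [e3]
          refine mul_le_mul_of_nonneg_left ?_ hC0.le
          nlinarith [mul_nonneg hl0 (by nlinarith [sq_nonneg s] : (0:ℝ) ≤ (1 + s ^ 2) ^ 2 - 1), sq_nonneg s, sq_nonneg (s ^ 2),
            mul_nonneg (sq_nonneg M) (by nlinarith [sq_nonneg s] : (0:ℝ) ≤ (1 + s ^ 2) ^ 2 - 1)]
  · exact integrable_inv_one_add_sq.const_mul K
  · refine Eventually.of_forall fun s ↦ ?_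
    exact ((continuous_const.mul (Complex.continuous_ofReal.comp
      (continuous_reDigammaQuarter.comp (continuous_const.add continuous_id)))).continuousAt)

/-- Continuity of `t ↦ B(a, t)`. [folklore] -/
theorem continuous_slotB (a : ℝ) : Continuous (slotB a) :=
  (continuous_archTerm a).sub (continuous_primePoly a)

/-- Continuity of `t ↦ R(a, t)`. [folklore] -/
theorem continuous_slotRem (a : ℝ) : Continuous (slotRem a) := by
  unfold slotRem
  refine (continuous_zeroSumPlus a).sub (Continuous.mul (by fun_prop) (continuous_slotB a))

/-! ## The product over the slots -/

/-- Generic product estimate: if `‖x_j‖ ≤ X_j`, `‖y_j‖ ≤ Y_j ε` with `X_j, Y_j ≤ K_j`, `K_j ≥ 1`, `0 ≤ ε ≤ 1`,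
then `‖Π_j (x_j + y_j) − Π_j x_j‖ ≤ 2ⁿ (Π_j K_j) ε` (expand, every term but `Π x_j` contains a factor `y`).
[folklore] -/
theorem norm_prod_add_sub_prod_le {n : ℕ} (x y : Fin n → ℂ) (K : Fin n → ℝ) {ε : ℝ} (hε0 : 0 ≤ ε) (hε1 : ε ≤ 1)
    (hK : ∀ j, 1 ≤ K j) (hx : ∀ j, ‖x j‖ ≤ K j) (hy : ∀ j, ‖y j‖ ≤ K j * ε) :
    ‖∏ j, (x j + y j) - ∏ j, x j‖ ≤ 2 ^ n * (∏ j, K j) * ε := by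
  classical
  have hK0 : ∀ j, 0 ≤ K j := fun j ↦ zero_le_one.trans (hK j)
  rw [Finset.prod_add]
  -- split off the term `S = univ`
  rw [← Finset.sum_erase_add _ _ (Finset.mem_powerset_self Finset.univ)]
  simp only [Finset.sdiff_self, Finset.prod_empty, mul_one, add_sub_cancel_right]
  refine (norm_sum_le _ _).trans ?_
  have hterm : ∀ S ∈ (Finset.univ : Finset (Fin n)).powerset.erase Finset.univ,
      ‖(∏ j ∈ S, x j) * ∏ j ∈ Finset.univ \ S, y j‖ ≤ (∏ j, K j) * ε := by
    intro S hS
    obtain ⟨hne, -⟩ := Finset.mem_erase.1 hS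
    -- pick `j₀ ∉ S`
    have : (Finset.univ \ S).Nonempty := by
      rw [Finset.sdiff_nonempty]; intro h; exact hne (Finset.univ_subset_iff.1 h)
    obtain ⟨j₀, hj₀⟩ := this
    rw [norm_mul, norm_prod, norm_prod, ← Finset.mul_prod_erase _ _ hj₀]
    calc (∏ j ∈ S, ‖x j‖) * (‖y j₀‖ * ∏ j ∈ (Finset.univ \ S).erase j₀, ‖y j‖)
        ≤ (∏ j ∈ S, K j) * ((K j₀ * ε) * ∏ j ∈ (Finset.univ \ S).erase j₀, K j) := by
          refine mul_le_mul (Finset.prod_le_prod (fun j _ ↦ norm_nonneg _) fun j _ ↦ hx j)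
            (mul_le_mul (hy j₀) (Finset.prod_le_prod (fun j _ ↦ norm_nonneg _) fun j _ ↦ (hy j).trans ?_)
              (Finset.prod_nonneg fun j _ ↦ norm_nonneg _) (mul_nonneg (hK0 _) hε0))
            (mul_nonneg (norm_nonneg _) (Finset.prod_nonneg fun j _ ↦ norm_nonneg _))
            (Finset.prod_nonneg fun j _ ↦ hK0 j)
          calc K j * ε ≤ K j * 1 := mul_le_mul_of_nonneg_left hε1 (hK0 j)
            _ = K j := mul_one _
      _ = ((∏ j ∈ S, K j) * (K j₀ * ∏ j ∈ (Finset.univ \ S).erase j₀, K j)) * ε := by ring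
      _ = ((∏ j ∈ S, K j) * ∏ j ∈ Finset.univ \ S, K j) * ε := by rw [Finset.mul_prod_erase _ _ hj₀]
      _ = (∏ j, K j) * ε := by
          rw [mul_comm (∏ j ∈ S, K j), Finset.prod_sdiff (Finset.subset_univ S)]
  calc ∑ S ∈ (Finset.univ : Finset (Fin n)).powerset.erase Finset.univ, ‖(∏ j ∈ S, x j) * ∏ j ∈ Finset.univ \ S, y j‖
      ≤ ∑ _S ∈ (Finset.univ : Finset (Fin n)).powerset.erase Finset.univ, (∏ j, K j) * ε := Finset.sum_le_sum hterm
    _ ≤ ∑ _S ∈ (Finset.univ : Finset (Fin n)).powerset, (∏ j, K j) * ε :=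
        Finset.sum_le_sum_of_subset_of_nonneg (Finset.erase_subset _ _) fun _ _ _ ↦
          mul_nonneg (Finset.prod_nonneg fun j _ ↦ hK0 j) hε0
    _ = 2 ^ n * (∏ j, K j) * ε := by
        rw [Finset.sum_const, Finset.card_powerset, Finset.card_univ, Fintype.card_fin, nsmul_eq_mul]
        push_cast; ring

/-- **The product of the windowed zero sums over the slots, up to the remainders** (RH): for
frequencies with `Σ_j a_j = 0` and `t ≥ 0`,
`‖Π_j S⁺(a_j, t) − Π_j B(a_j, t)‖ ≤ 2ⁿ Kⁿ (log(t+2)+1)ⁿ e^{Σ_j |a_j|/2}/(1+t²)` with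
`K = max(C_B, C_R, 1)` (the phases `e^{ia_jt}` cancel: Rudnick–Sarnak 1996, (3.11)–(3.12) with
`Σ ξ_j = 0`). [cite: RudnickSarnak1996, (3.12)–(3.15)] -/
theorem norm_prod_zeroSumPlus_sub_prod_slotB_le (hRH : RiemannHypothesis) (a : Fin (k + 1) → ℝ)
    (ha : ∑ j, a j = 0) {t : ℝ} (ht : 0 ≤ t) :
    ‖∏ j, zeroSumPlus (a j) t - ∏ j, slotB (a j) t‖ ≤
      2 ^ (k + 1) * (max (max slotBConst remConst) 1 * (Real.log (t + 2) + 1)) ^ (k + 1) *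
        Real.exp ((∑ j, |a j|) / 2) / (1 + t ^ 2) := by
  set Kc : ℝ := max (max slotBConst remConst) 1
  have hKc1 : 1 ≤ Kc := le_max_right _ _
  have hKcB : slotBConst ≤ Kc := (le_max_left _ _).trans (le_max_left _ _)
  have hKcR : remConst ≤ Kc := (le_max_right _ _).trans (le_max_left _ _)
  have hlog : 0 ≤ Real.log (t + 2) := Real.log_nonneg (by linarith)
  have habs : |t| = t := abs_of_nonneg ht
  set x : Fin (k + 1) → ℂ := fun j ↦ cexp (((t * a j : ℝ) : ℂ) * I) * slotB (a j) t
  set y : Fin (k + 1) → ℂ := fun j ↦ slotRem (a j) t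
  set K : Fin (k + 1) → ℝ := fun j ↦ Kc * (Real.log (t + 2) + 1) * Real.exp (|a j| / 2)
  have hprod : ∏ j, zeroSumPlus (a j) t = ∏ j, (x j + y j) := Finset.prod_congr rfl fun j _ ↦ zeroSumPlus_eq _ _
  have hphase : ∏ j, x j = ∏ j, slotB (a j) t := by
    simp only [x]
    rw [Finset.prod_mul_distrib, ← Complex.exp_sum]
    have : ∑ j, (((t * a j : ℝ) : ℂ)) * I = 0 := by
      rw [← Finset.sum_mul, ← Complex.ofReal_sum, ← Finset.mul_sum, ha]; simp
    rw [this, Complex.exp_zero, one_mul]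
  rw [hprod, ← hphase]
  have hε0 : (0 : ℝ) ≤ 1 / (1 + t ^ 2) := by positivity
  have hε1 : 1 / (1 + t ^ 2) ≤ 1 := by rw [div_le_one (by positivity)]; nlinarith
  have hK1 : ∀ j, 1 ≤ K j := fun j ↦ by
    simp only [K]
    have : 1 ≤ Real.exp (|a j| / 2) := Real.one_le_exp (by positivity)
    nlinarith [mul_nonneg (by linarith : (0:ℝ) ≤ Kc - 1) hlog]
  have hx : ∀ j, ‖x j‖ ≤ K j := fun j ↦ by
    simp only [x, K]
    rw [norm_mul, Complex.norm_exp_ofReal_mul_I, one_mul]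
    refine (norm_slotB_le _ _).trans ?_
    rw [habs]
    gcongr
  have hy : ∀ j, ‖y j‖ ≤ K j * (1 / (1 + t ^ 2)) := fun j ↦ by
    simp only [y, K]
    refine (norm_slotRem_le hRH _ ht).trans ?_
    rw [mul_one_div]
    refine div_le_div_of_nonneg_right ?_ (by positivity)
    have : Real.exp (|a j| / 2) ≤ (Real.log (t + 2) + 1) * Real.exp (|a j| / 2) := by nlinarith [Real.exp_pos (|a j| / 2)]
    calc remConst * Real.exp (|a j| / 2) ≤ Kc * ((Real.log (t + 2) + 1) * Real.exp (|a j| / 2)) :=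
          mul_le_mul hKcR this (Real.exp_pos _).le (by linarith)
      _ = Kc * (Real.log (t + 2) + 1) * Real.exp (|a j| / 2) := by ring
  refine (norm_prod_add_sub_prod_le x y K hε0 hε1 hK1 hx hy).trans (le_of_eq ?_)
  simp only [K]
  rw [Finset.prod_mul_distrib, Finset.prod_const, Finset.card_univ, Fintype.card_fin, ← Real.exp_sum, ← Finset.sum_div]
  ring

/-! ## One application of Fubini -/

/-- The slot product integrand `(η, t) ↦ Π_j S⁺(−Lξ_j(η), t)` is jointly continuous. [folklore] -/
theorem continuous_prod_zeroSumPlus_slice (L : ℝ) :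
    Continuous fun p : (Fin k → ℝ) × ℝ ↦ ∏ j, zeroSumPlus (-(L * slicePt p.1 j)) p.2 := by
  refine continuous_finsetProd _ fun j _ ↦ ?_
  have h1 : Continuous fun p : (Fin k → ℝ) × ℝ ↦ (-(L * slicePt p.1 j), p.2) :=
    Continuous.prodMk ((continuous_const.mul ((continuous_slicePt_apply j).comp continuous_fst)).neg) continuous_snd
  exact continuous_zeroSumPlus_uncurry.comp h1

/-- **`sliceIntegral` with the `t`-integral inside**: for `T ≥ 0` and `Φ` integrable on the slice,
`∫_0^T ∫_η Φ(ξ(η)) Π_j S⁺(−Lξ_j(η), t) dη dt = ∫_η Φ(ξ(η)) (∫_0^T Π_j S⁺(−Lξ_j(η), t) dt) dη`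
(Fubini; domination by `‖Φ(ξ(η))‖ (sup_{[0,T]} Σ_n κ(t−γ_n))ⁿ`). [folklore] -/
theorem sliceIntegral_eq_integral_slotIntegral {Φ : (Fin (k + 1) → ℝ) → ℂ}
    (hΦ : Integrable fun η : Fin k → ℝ ↦ Φ (slicePt η)) {T : ℝ} (hT : 0 ≤ T) :
    sliceIntegral Φ T = ∫ η : Fin k → ℝ, Φ (slicePt η) *
      ∫ t in (0 : ℝ)..T, ∏ j, zeroSumPlus (-(Real.log T * slicePt η j)) t := by
  set L := Real.log T
  -- a uniform bound for the slot product on `[0, T]`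
  set D : ℝ → ℝ := fun t ↦ ∑' n : ℕ, ker (t - zetaOrdinate n)
  obtain ⟨B, hB⟩ : ∃ B : ℝ, ∀ t ∈ Icc 0 T, D t ^ (k + 1) ≤ B := by
    have hc : ContinuousOn (fun t ↦ D t ^ (k + 1)) (Icc 0 T) := (continuous_tsum_ker_sub.pow _).continuousOn
    obtain ⟨B, hB⟩ := (isCompact_Icc.image_of_continuousOn hc).isBounded.bddAbove
    exact ⟨B, fun t ht ↦ hB (Set.mem_image_of_mem _ ht)⟩
  have hbound : ∀ η : Fin k → ℝ, ∀ t ∈ Icc 0 T, ‖∏ j, zeroSumPlus (-(L * slicePt η j)) t‖ ≤ B := by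
    intro η t ht
    refine le_trans ?_ (hB t ht)
    rw [norm_prod, show D t ^ (k + 1) = ∏ _j : Fin (k + 1), D t by simp]
    exact Finset.prod_le_prod (fun j _ ↦ norm_nonneg _) fun j _ ↦ norm_zeroSumPlus_le _ _
  have hB0 : 0 ≤ B := le_trans (norm_nonneg _) (hbound 0 0 ⟨le_rfl, hT⟩)
  -- integrability on the restricted product
  set F : (Fin k → ℝ) × ℝ → ℂ := fun p ↦ Φ (slicePt p.1) * ∏ j, zeroSumPlus (-(L * slicePt p.1 j)) p.2
  set μ : Measure ((Fin k → ℝ) × ℝ) := (volume : Measure (Fin k → ℝ)).prod ((volume : Measure ℝ).restrict (Ioc 0 T))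
  have hμ : μ = ((volume : Measure (Fin k → ℝ)).prod (volume : Measure ℝ)).restrict (univ ×ˢ Ioc 0 T) := by
    simp only [μ]
    rw [← Measure.prod_restrict, Measure.restrict_univ]
  have hFmeas : AEStronglyMeasurable F μ :=
    (hΦ.aestronglyMeasurable.comp_fst).mul (continuous_prod_zeroSumPlus_slice L).aestronglyMeasurable
  have hg : Integrable (fun p : (Fin k → ℝ) × ℝ ↦ ‖Φ (slicePt p.1)‖ * B) μ :=
    hΦ.norm.mul_prod (integrable_const B)
  have hFint : Integrable F μ := by
    refine hg.mono' hFmeas ?_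
    rw [hμ, ae_restrict_iff' (MeasurableSet.univ.prod measurableSet_Ioc)]
    refine Eventually.of_forall fun p hp ↦ ?_
    simp only [F]
    rw [norm_mul]
    exact mul_le_mul_of_nonneg_left (hbound p.1 p.2 ⟨hp.2.1.le, hp.2.2⟩) (norm_nonneg _)
  -- swap
  unfold sliceIntegral
  rw [intervalIntegral.integral_of_le hT]
  have hswap := MeasureTheory.integral_integral_swap (f := fun (t : ℝ) (η : Fin k → ℝ) ↦ F (η, t)) hFint.swap
  simp only [F] at hswap
  rw [hswap]
  congr 1 with η
  rw [intervalIntegral.integral_of_le hT, ← integral_const_mul]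

end RudnickSarnakN

end Literature.NumberTheory.LFunctions

end
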